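import Summits.BirchSwinnertonDyer.BirchSwinnertonDyer.Theorems.ManinLocalTwoThreeSixteenSplitCore
import Summits.BirchSwinnertonDyer.Rank1Residual.ManinAdditive.ShimuraKernelHolds
import HarnessLib

/-!
# THE KERNEL-ROW ROAD for C2's reducible locus, POINTWISE: Kato–Néron integrality at the X₁-optimal curve + an's Shimura-kernel rows
# E-an-152 / E-an-152b AT ONE DATUM ⟹ `2 ∤ c₀` — no F★, no cuspidal-Kummer certificate; and the resulting ALTERNATIVE composition of C2 on the core
# (route `ManinLocalTwoThree`, cell bsd-f2-manin; crux C2 `ManinOddAtFour` stmt-BirchSwinnertonDyer-22967; LEAD seat p1 gen 13 — insurance against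
# E-an-48's `η`-quotient form failing at `16 ∣ N`, an g14 caveat / an g34 census)

THE POINT.  an §76 (MEMO-an §76, typer p701658/p702389): on globally minimal `a₁ = a₃ = 0` models, `|c₀| = |c₁|` follows from the two `c`-free lattice rows
E-an-152 `ShimuraKernelBlindAtFour` (at Shimura index 2 the kernel point is a Kummer-BLIND rational 2-torsion point) and E-an-152b `ShimuraIndexNeFourAtFour`
(the index is never 4) — `ShimuraKernel.transfer_of_kernel_rows'`, with S-an-65 `kernelToLedgerEdge_holds` PROVED.  Those tree theorems take the rows as
GLOBAL laws; this file re-runs S-an-65's proof with the rows supplied AT THE ONE DATUM `(W₀, D₀)` (`natAbs_maninConstant_eq_of_kernelRowsAt`), so that the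
rows can be READ ON THE CORE like the other stubs.  With the Γ₁ lever (`not_two_dvd_maninConstant₁_of_katoFactAt`) this gives the reducible locus of C2 from
Kato–Néron integrality at the `X₁(N)`-optimal curve + the two rows at the datum (`not_two_dvd_maninConstant_of_katoFactAt₁_of_kernelRowsAt`), and an
ALTERNATIVE core composition of the route decl (`maninOddAtFour_of_katoFact_of_levelSixteenCoreKernelRows`): inputs {F♯, hex, F-es-21♭K} printed +
{E-an-152@core, E-an-152b@core, Kato–Néron integrality at the X₁-optimal curve of every REDUCIBLE core class off the period-dominated locus} — SIX stubs, no
F★ and no E-an-48/53, at the price of asking es's law on all reducible core classes instead of the totally blind ones.  (Not registered as the line of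
record — skeleton v20 keeps the certificate road; this is the LEAD's fallback, landed so the planner-of-record can switch by name.)

HONEST FRAMING.  CONDITIONAL reductions over OPEN laws (E-an-152, E-an-152b, E-es-110-type Kato law) and statement-only facts (F♯, hex, F-es-21♭K).
C2, Manin's conjecture, Stevens' conjecture and BSD are NOT proved.  No definitions, no sorry, axioms standard.
-/

set_option autoImplicit false
-- lint-debt: the directory name repeats the summit name (sibling precedent `ManinLocalTwoThreeGammaOneKatoRoad.lean`)
set_option linter.dupNamespace false

noncomputable section

open scoped Classical MatrixGroups ModularForm NumberField
open PowerSeries CongruenceSubgroup IsDedekindDomain IsDedekindDomain.HeightOneSpectrum Rat.HeightOneSpectrum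
open WeierstrassCurve Literature.NumberTheory.DiophantineGeometry Literature.NumberTheory.EllipticCurves
  Literature.NumberTheory.EllipticCurves.ModularForms Literature.RingTheory.FormalGroups
open Summit.BirchSwinnertonDyer.Rank1Residual.ManinAdditive
open Summit.BirchSwinnertonDyer.Rank1Residual.ManinAdditive.CuspidalKummer
open Summit.BirchSwinnertonDyer.Rank1Residual.ManinAdditive.ShimuraLedger
open Summit.BirchSwinnertonDyer.Rank1Residual.ManinAdditive.KatoCurve
open Summit.BirchSwinnertonDyer.Rank1Residual.ManinAdditive.ShimuraKernel

namespace Summit.BirchSwinnertonDyer.BirchSwinnertonDyer.Theorems.ManinLocalTwoThree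

/-! ## §1 S-an-65 POINTWISE: the two kernel rows AT THE DATUM ⟹ `|c₀| = |c₁|` -/

/-- **`|c₀| = |c₁|` from E-an-152 and E-an-152b AT ONE DATUM** (`a₁ = a₃ = 0`, `4 ∣ N`): an's S-an-65 `kernelToLedgerEdge_holds` re-run with the rows
supplied at `(W₀, D₀)` only — dichotomy `|c₀| ∈ {|c₁|, 2|c₁|}`, Ling–Oesterlé `2Λ₀ ⊆ Λ₁`, `halfLattice_trichotomy`; index 4 excluded by the 152b instance,
index 1 forces `Λ₁ = Λ₀`, index 2 produces the half-period whose root E-an-152 makes blind and the Vélu step `false_of_blind_halfPeriod_neronLattice`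
refutes. [cite: LingOesterle1991, Thm. 6] [cite: CesnaviciusNeururerSaha2023, Lemma 6.5 (shape: c₁ ∣ c₀ ∣ 2c₁)] -/
theorem natAbs_maninConstant_eq_of_kernelRowsAt
    {W₁ W₀ : WeierstrassCurve ℚ} [W₁.IsElliptic] [W₁.IsGloballyMinimal] [W₀.IsElliptic] [W₀.IsGloballyMinimal]
    {N : ℕ} [NeZero N] (D₁ : Gamma1ParametrizationData W₁ N) (D₀ : ModularParametrizationData W₀ N)
    (hiso : IsIsogenous W₁ W₀) (h₁ : D₁.IsOptimal)
    (h₀ : ∀ z ∈ D₀.L.lattice, ∃ w ∈ periodLattice D₀.f, z = D₀.c * w) (h4 : 2 ^ 2 ∣ N)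
    (ha₁ : W₀.a₁ = 0) (ha₃ : W₀.a₃ = 0)
    (h152at : periodLatticeGamma1 D₀.f ≠ periodLattice D₀.f →
      ∀ w ∈ periodLatticeGamma1 D₀.f, (∀ v ∈ periodLattice D₀.f, w ≠ 2 * v) →
        ∃ A₂ A₄ E : ℤ, (A₂ : ℚ) = W₀.a₂ ∧ (A₄ : ℚ) = W₀.a₄ ∧
          (E : ℚ) ^ 3 + W₀.a₂ * (E : ℚ) ^ 2 + W₀.a₄ * E + W₀.a₆ = 0 ∧
          D₀.L.weierstrassP ((D₀.c : ℂ) * w / 2) = (((E : ℚ) + W₀.a₂ / 3 : ℚ) : ℂ) ∧ KummerBlindAtTwo A₂ A₄ E)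
    (h152bat : ¬ (∀ z : ℂ, z ∈ periodLatticeGamma1 D₀.f ↔ ∃ w ∈ periodLattice D₀.f, z = 2 * w)) :
    D₀.maninConstant.natAbs = D₁.maninConstant.natAbs := by
  have hf : D₁.f = D₀.f := D₁.f_eq_of_isIsogenous D₀ hiso
  have hne4 : ¬ (∀ z : ℂ, z ∈ periodLatticeGamma1 D₁.f ↔ ∃ w ∈ periodLattice D₀.f, z = 2 * w) :=
    fun hidx ↦ h152bat (fun z ↦ by simpa only [hf] using hidx z)
  rcases natAbs_maninConstant₀_eq_or_eq_two_mul_of_four_dvd_level D₁ D₀ hiso h₁ h₀ h4 with heq | hdouble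
  · exact heq
  exfalso
  have hc₁ : (D₁.c : ℂ) ≠ 0 := by exact_mod_cast D₁.maninConstant_ne_zero
  have hc₁0 : D₁.maninConstant.natAbs ≠ 0 := Int.natAbs_ne_zero.mpr D₁.maninConstant_ne_zero
  obtain ⟨ε, hε, hcc⟩ : ∃ ε : ℂ, (ε = 1 ∨ ε = -1) ∧ (D₀.c : ℂ) = ε * (2 * D₁.c) := by
    have h : D₀.maninConstant.natAbs = (2 * D₁.maninConstant).natAbs := by rw [hdouble, Int.natAbs_mul]; rfl
    rcases Int.natAbs_eq_natAbs_iff.mp h with h' | h'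
    · exact ⟨1, Or.inl rfl, by rw [one_mul]; exact_mod_cast h'⟩
    · exact ⟨-1, Or.inr rfl, by rw [neg_one_mul]; exact_mod_cast h'⟩
  have hε2 : ε * ε = 1 := by rcases hε with rfl | rfl <;> norm_num
  have hεmem : ∀ (S : AddSubgroup ℂ) (w : ℂ), w ∈ S → ε * w ∈ S := by
    intro S w hw; rcases hε with rfl | rfl
    · rwa [one_mul]
    · rw [neg_one_mul]; exact neg_mem hw
  have h2Λ : ∀ w ∈ periodLattice D₀.f, (2 : ℂ) * w ∈ periodLatticeGamma1 D₀.f := fun w hw ↦ by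
    have h := pMulLatticeLeGamma1OfTracelessPrime_holds N D₀.f D₀.isNewformOf.1 2 Nat.prime_two
      ((dvd_pow_self 2 two_ne_zero).trans h4) (D₀.isNewformOf.1.cuspCoeff_eq_zero_of_sq_dvd Nat.prime_two h4) w hw
    exact_mod_cast h
  have hle : D₀.L.lattice ≤ D₁.L.lattice := by
    intro z hz
    obtain ⟨w, hw, rfl⟩ := h₀ z hz
    have h2w : ε * ((2 : ℂ) * w) ∈ periodLatticeGamma1 D₁.f := by rw [hf]; exact hεmem _ _ (h2Λ w hw)
    have e : (D₀.c : ℂ) * w = (D₁.c : ℂ) * (ε * (2 * w)) := by rw [hcc]; ring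
    rw [e]
    exact D₁.smul_periodLatticeGamma1_le _ h2w
  have htwo : ∀ w ∈ D₁.L.lattice, 2 * w ∈ D₀.L.lattice := by
    intro w hw
    obtain ⟨w₁, hw₁, rfl⟩ := h₁ w hw
    have hw₀ : ε * w₁ ∈ periodLattice D₀.f := hεmem _ _ (hf ▸ periodLatticeGamma1_le_periodLattice D₁.f hw₁)
    have e : 2 * ((D₁.c : ℂ) * w₁) = (D₀.c : ℂ) * (ε * w₁) := by
      rw [hcc]; linear_combination -(2 * (D₁.c : ℂ) * w₁) * hε2
    rw [e]
    exact D₀.smul_periodLattice_le _ hw₀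
  have hΛne : periodLatticeGamma1 D₀.f ≠ periodLattice D₀.f := by
    intro hΛ
    have heq := natAbs_maninConstant₀_eq_of_periodLatticeGamma1_eq_periodLattice D₁ D₀ h₁ h₀ hf hΛ
    omega
  rcases halfLattice_trichotomy D₀.L D₁.L hle htwo with hcase | hcase | hcase
  · apply hne4
    intro z
    constructor
    · intro hz
      have hz' : (D₁.c : ℂ) * z ∈ D₀.L.lattice := hcase _ (D₁.smul_periodLatticeGamma1_le z hz)
      obtain ⟨w, hw, hw'⟩ := h₀ _ hz'
      refine ⟨ε * w, hεmem _ _ hw, ?_⟩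
      have h : (D₁.c : ℂ) * z = (D₁.c : ℂ) * (2 * (ε * w)) := by rw [hw', hcc]; ring
      exact mul_left_cancel₀ hc₁ h
    · rintro ⟨w, hw, rfl⟩
      rw [hf]; exact h2Λ w hw
  · apply hΛne
    refine le_antisymm (periodLatticeGamma1_le_periodLattice D₀.f) fun w hw ↦ ?_
    have h2h : 2 * (ε * ((D₁.c : ℂ) * w)) ∈ D₀.L.lattice := by
      have e : 2 * (ε * ((D₁.c : ℂ) * w)) = (D₀.c : ℂ) * w := by rw [hcc]; ring
      rw [e]; exact D₀.smul_periodLattice_le w hw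
    obtain ⟨w₁, hw₁, hw₁'⟩ := h₁ _ (hcase _ h2h)
    have hw' : w = ε * w₁ := by
      have h : (D₁.c : ℂ) * w = (D₁.c : ℂ) * (ε * w₁) := by
        linear_combination ε * hw₁' - ((D₁.c : ℂ) * w) * hε2
      exact mul_left_cancel₀ hc₁ h
    rw [hw', ← hf]; exact hεmem _ _ hw₁
  · obtain ⟨z₀, hz₀', hz₀, hidx⟩ := hcase
    have h2z₀ : 2 * z₀ ∈ D₀.L.lattice := htwo z₀ hz₀'
    obtain ⟨w₁, hw₁, hzw⟩ := h₁ z₀ hz₀'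
    have hw : ε * w₁ ∈ periodLatticeGamma1 D₀.f := hf ▸ hεmem _ _ hw₁
    have hzε : (D₀.c : ℂ) * (ε * w₁) / 2 = z₀ := by
      rw [hzw, hcc]; linear_combination ((D₁.c : ℂ) * w₁) * hε2
    have hw2 : ∀ v ∈ periodLattice D₀.f, ε * w₁ ≠ 2 * v := by
      intro v hv hvw
      apply hz₀
      have e : z₀ = (D₀.c : ℂ) * v := by
        rw [← hzε, hvw]; ring
      rw [e]; exact D₀.smul_periodLattice_le v hv
    obtain ⟨A₂, A₄, E, hA₂, hA₄, heE, hxE, hbl⟩ := h152at hΛne (ε * w₁) hw hw2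
    rw [hzε] at hxE
    exact false_of_blind_halfPeriod_neronLattice ha₁ ha₃ D₀.isNeronLattice D₁.isNeronLattice hA₂ hA₄ heE hbl
      hz₀ h2z₀ hxE hle hz₀' hidx

/-! ## §2 The reducible locus of C2 from Kato at the X₁-optimal curve + the kernel rows AT THE DATUM -/

/-- **`a₁ = a₃ = 0`, `4 ∣ N`: `2 ∤ c₀` from `KatoFactTwoAt` at an optimal `X₁(N)`-curve of the class (Γ₁ lever: `2 ∤ c₁`) and the two kernel rows at the
datum (`|c₀| = |c₁|`, §1)** — no F★, no cuspidal-Kummer certificate. [cite: LingOesterle1991, Thm. 6] -/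
theorem not_two_dvd_maninConstant_of_katoFactAt₁_of_kernelRowsAt
    {W₁ W₀ : WeierstrassCurve ℚ} [W₁.IsElliptic] [W₁.IsGloballyMinimal] [W₀.IsElliptic] [W₀.IsGloballyMinimal]
    {N : ℕ} [NeZero N] (D₁ : Gamma1ParametrizationData W₁ N) (D₀ : ModularParametrizationData W₀ N)
    (hiso : IsIsogenous W₁ W₀) (h₁ : D₁.IsOptimal)
    (h₀ : ∀ z ∈ D₀.L.lattice, ∃ w ∈ periodLattice D₀.f, z = D₀.c * w) (h4 : 2 ^ 2 ∣ N)
    (ha₁ : W₀.a₁ = 0) (ha₃ : W₀.a₃ = 0)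
    (h152at : periodLatticeGamma1 D₀.f ≠ periodLattice D₀.f →
      ∀ w ∈ periodLatticeGamma1 D₀.f, (∀ v ∈ periodLattice D₀.f, w ≠ 2 * v) →
        ∃ A₂ A₄ E : ℤ, (A₂ : ℚ) = W₀.a₂ ∧ (A₄ : ℚ) = W₀.a₄ ∧
          (E : ℚ) ^ 3 + W₀.a₂ * (E : ℚ) ^ 2 + W₀.a₄ * E + W₀.a₆ = 0 ∧
          D₀.L.weierstrassP ((D₀.c : ℂ) * w / 2) = (((E : ℚ) + W₀.a₂ / 3 : ℚ) : ℂ) ∧ KummerBlindAtTwo A₂ A₄ E)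
    (h152bat : ¬ (∀ z : ℂ, z ∈ periodLatticeGamma1 D₀.f ↔ ∃ w ∈ periodLattice D₀.f, z = 2 * w))
    (hK : KatoFactTwoAt W₁ D₁.f) : ¬ (2 : ℤ) ∣ D₀.maninConstant := by
  have heq := natAbs_maninConstant_eq_of_kernelRowsAt D₁ D₀ hiso h₁ h₀ h4 ha₁ ha₃ h152at h152bat
  have hodd := not_two_dvd_maninConstant₁_of_katoFactAt W₁ D₁ h₁ h4 hK
  intro hdvd
  apply hodd
  have : (2 : ℤ).natAbs ∣ D₁.maninConstant.natAbs := by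
    rw [← heq]; exact Int.natAbs_dvd_natAbs.mpr hdvd
  exact Int.natAbs_dvd_natAbs.mp this

/-! ## §3 The ALTERNATIVE composition: C2 on the core from {F♯, hex, F-es-21♭K} + {E-an-152, E-an-152b, Kato at E₁} (no F★, no E-an-48/53) -/

/-- **C2 LEVEL-WISE on the core by the kernel-row road.**  Fix `N`, `4 ∣ N`.  Irreducible `W[2]`: F♯ through the X₁-optimal curve (Γ₁ road).
Reducible: the `u = 1` change to the `a₁ = a₃ = 0` model, Stevens' datum by hex, `KatoFactTwoAt` at it (law, guard: the class contains a lattice-optimal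
`a₁ = a₃ = 0` core datum with a rational 2-torsion point), and the two kernel rows at the model (§2).  CONDITIONAL; nothing about BSD is proved.
[cite: Kato2004Asterisque, Thm. 12.5 (1) (p. 221) (F♯)] [cite: Stevens1989, §2] [cite: LingOesterle1991, Thm. 6] -/
theorem not_two_dvd_maninConstant_of_levelKernelRows_core
    (hF : kato_neron_isIntegral_twistedSymbolSum_of_additive_two_real) (hex : exists_optimal_gamma1ParametrizationData)
    {N : ℕ} [NeZero N] (h4 : 2 ^ 2 ∣ N)
    (h152N : ∀ (V : WeierstrassCurve ℚ) [V.IsElliptic] [V.IsGloballyMinimal] (D : ModularParametrizationData V N),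
      (∀ z ∈ D.L.lattice, ∃ w ∈ periodLattice D.f, z = D.c * w) → V.a₁ = 0 → V.a₃ = 0 →
      ((primesEquiv (R := 𝓞 ℚ)).symm ⟨2, Nat.prime_two⟩).valuation ℚ V.j < 1 → (∀ d : ℤ, d = -1 ∨ d = 2 ∨ d = -2 → 2 ≤ (V.quadraticTwist (d : ℚ)).conductorExponent ((primesEquiv (R := ℤ)).symm ⟨2, Nat.prime_two⟩)) →
      (periodLatticeGamma1 D.f ≠ periodLattice D.f →
        ∀ w ∈ periodLatticeGamma1 D.f, (∀ v ∈ periodLattice D.f, w ≠ 2 * v) →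
          ∃ A₂ A₄ E : ℤ, (A₂ : ℚ) = V.a₂ ∧ (A₄ : ℚ) = V.a₄ ∧
            (E : ℚ) ^ 3 + V.a₂ * (E : ℚ) ^ 2 + V.a₄ * E + V.a₆ = 0 ∧
            D.L.weierstrassP ((D.c : ℂ) * w / 2) = (((E : ℚ) + V.a₂ / 3 : ℚ) : ℂ) ∧ KummerBlindAtTwo A₂ A₄ E))
    (h152bN : ∀ (V : WeierstrassCurve ℚ) [V.IsElliptic] [V.IsGloballyMinimal] (D : ModularParametrizationData V N),
      (∀ z ∈ D.L.lattice, ∃ w ∈ periodLattice D.f, z = D.c * w) → V.a₁ = 0 → V.a₃ = 0 →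
      ((primesEquiv (R := 𝓞 ℚ)).symm ⟨2, Nat.prime_two⟩).valuation ℚ V.j < 1 → (∀ d : ℤ, d = -1 ∨ d = 2 ∨ d = -2 → 2 ≤ (V.quadraticTwist (d : ℚ)).conductorExponent ((primesEquiv (R := ℤ)).symm ⟨2, Nat.prime_two⟩)) →
      (¬ (∀ z : ℂ, z ∈ periodLatticeGamma1 D.f ↔ ∃ w ∈ periodLattice D.f, z = 2 * w)))
    (hKatoN : ∀ (V : WeierstrassCurve ℚ) [V.IsElliptic] [V.IsGloballyMinimal] (D₁ : Gamma1ParametrizationData V N),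
      D₁.IsOptimal → (∃ (W₀ : WeierstrassCurve ℚ) (_ : W₀.IsElliptic) (_ : W₀.IsGloballyMinimal) (D₀ : ModularParametrizationData W₀ N),
        IsIsogenous V W₀ ∧ (∀ z ∈ D₀.L.lattice, ∃ w ∈ periodLattice D₀.f, z = D₀.c * w) ∧
        W₀.a₁ = 0 ∧ W₀.a₃ = 0 ∧ HasRationalTwoTorsion W₀ ∧
        ((primesEquiv (R := 𝓞 ℚ)).symm ⟨2, Nat.prime_two⟩).valuation ℚ W₀.j < 1 ∧ (∀ d : ℤ, d = -1 ∨ d = 2 ∨ d = -2 → 2 ≤ (W₀.quadraticTwist (d : ℚ)).conductorExponent ((primesEquiv (R := ℤ)).symm ⟨2, Nat.prime_two⟩))) → KatoFactTwoAt V D₁.f)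
    (W : WeierstrassCurve ℚ) [W.IsElliptic] [W.IsGloballyMinimal] (D : ModularParametrizationData W N)
    (hopt : ∀ z ∈ D.L.lattice, ∃ w ∈ periodLattice D.f, z = D.c * w)
    (hss : ((primesEquiv (R := 𝓞 ℚ)).symm ⟨2, Nat.prime_two⟩).valuation ℚ W.j < 1) (hcore : (∀ d : ℤ, d = -1 ∨ d = 2 ∨ d = -2 → 2 ≤ (W.quadraticTwist (d : ℚ)).conductorExponent ((primesEquiv (R := ℤ)).symm ⟨2, Nat.prime_two⟩))) :
    ¬ (2 : ℤ) ∣ D.maninConstant := by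
  by_cases hirr : W.HasIrreducibleModPGaloisRep 2
  · exact katoManinOddTwo_of_real_of_exists_gamma1 hF hex W D hopt h4 hirr
  have h4' : 4 ∣ N := by norm_num at h4; exact h4
  obtain ⟨h2, hN2⟩ := lFunction_two_eq_zero_of_four_dvd W D.isNewformOf h4'
  have hadd := hasAdditiveReductionAt_two_of_lFunction_two_eq_zero W h2 hN2
  obtain ⟨C, M, hu, hCW, hM1, hM3, hmin⟩ := exists_smul_eq_map_a₁_a₃_eq_zero_of_hasAdditiveReductionAt_two W hadd
  haveI := hmin
  obtain ⟨D', hf, hc, hL, -⟩ := exists_modularParametrizationData_smul_of_u_eq_one W D C hu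
  have hopt' : ∀ z ∈ D'.L.lattice, ∃ w ∈ periodLattice D'.f, z = D'.c * w := by
    rw [hL, hf, hc]; exact hopt
  have ha₁ : (C • W).a₁ = 0 := by rw [hCW, map_a₁, hM1, map_zero]
  have ha₃ : (C • W).a₃ = 0 := by rw [hCW, map_a₃, hM3, map_zero]
  have hssC : ((primesEquiv (R := 𝓞 ℚ)).symm ⟨2, Nat.prime_two⟩).valuation ℚ (C • W).j < 1 := by
    rw [variableChange_j]; exact hss
  have hcoreC := twistCore_smul W C hcore
  have hred' : ¬ (C • W).HasIrreducibleModPGaloisRep 2 := by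
    rwa [Mazur1978.hasIrreducibleModPGaloisRep_smul_iff]
  obtain ⟨e, he⟩ := exists_isRoot_twoTorsionPolynomial_of_not_hasIrreducibleModPGaloisRep_two (C • W) hred'
  have hT : HasRationalTwoTorsion (C • W) := ⟨e, (isRoot_twoTorsionPolynomial_iff_of_a₁_a₃ (C • W) ha₁ ha₃ e).mp he⟩
  obtain ⟨W₁, i₁, i₂, D₁, hiso, hD₁⟩ := hex (C • W) D' hopt'
  have hK : KatoFactTwoAt W₁ D₁.f := hKatoN W₁ D₁ hD₁ ⟨C • W, inferInstance, hmin, D', hiso, hopt', ha₁, ha₃, hT, hssC, hcoreC⟩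
  have h := not_two_dvd_maninConstant_of_katoFactAt₁_of_kernelRowsAt D₁ D' hiso hD₁ hopt' h4 ha₁ ha₃
    (h152N (C • W) D' hopt' ha₁ ha₃ hssC hcoreC) (h152bN (C • W) D' hopt' ha₁ ha₃ hssC hcoreC) hK
  change ¬ (2 : ℤ) ∣ D'.c at h
  change ¬ (2 : ℤ) ∣ D.c
  rwa [hc] at h

/-- **C2 on the core ∩ {`16 ∣ N`} by the kernel-row road** — {F♯, hex, F-es-21♭K} + E-an-152 / E-an-152b read on the core at `16 ∣ N` (on `a₁ = a₃ = 0`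
lattice-optimal data) + Kato–Néron integrality at the X₁-optimal curve of REDUCIBLE core classes off the period-dominated locus.  CONDITIONAL.
[cite: Kato2004Asterisque, Thm. 12.5 (1) (p. 221)] [cite: Stevens1989, §2] -/
theorem maninOddAtSixteenCore_of_katoFact_of_levelSixteenCoreKernelRows
    (hF : kato_neron_isIntegral_twistedSymbolSum_of_additive_two_real) (hex : exists_optimal_gamma1ParametrizationData)
    (hK : kato_isIntegral_twistedSymbolSum_two_symbolClosure)
    (h152 : ∀ (W : WeierstrassCurve ℚ) [W.IsElliptic] [W.IsGloballyMinimal] {N : ℕ} [NeZero N]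
      (D : ModularParametrizationData W N),
      (∀ z ∈ D.L.lattice, ∃ w ∈ periodLattice D.f, z = D.c * w) → 2 ^ 4 ∣ N → W.a₁ = 0 → W.a₃ = 0 →
      ((primesEquiv (R := 𝓞 ℚ)).symm ⟨2, Nat.prime_two⟩).valuation ℚ W.j < 1 → (∀ d : ℤ, d = -1 ∨ d = 2 ∨ d = -2 → 2 ≤ (W.quadraticTwist (d : ℚ)).conductorExponent ((primesEquiv (R := ℤ)).symm ⟨2, Nat.prime_two⟩)) →
      (periodLatticeGamma1 D.f ≠ periodLattice D.f →
        ∀ w ∈ periodLatticeGamma1 D.f, (∀ v ∈ periodLattice D.f, w ≠ 2 * v) →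
          ∃ A₂ A₄ E : ℤ, (A₂ : ℚ) = W.a₂ ∧ (A₄ : ℚ) = W.a₄ ∧
            (E : ℚ) ^ 3 + W.a₂ * (E : ℚ) ^ 2 + W.a₄ * E + W.a₆ = 0 ∧
            D.L.weierstrassP ((D.c : ℂ) * w / 2) = (((E : ℚ) + W.a₂ / 3 : ℚ) : ℂ) ∧ KummerBlindAtTwo A₂ A₄ E))
    (h152b : ∀ (W : WeierstrassCurve ℚ) [W.IsElliptic] [W.IsGloballyMinimal] {N : ℕ} [NeZero N]
      (D : ModularParametrizationData W N),
      (∀ z ∈ D.L.lattice, ∃ w ∈ periodLattice D.f, z = D.c * w) → 2 ^ 4 ∣ N → W.a₁ = 0 → W.a₃ = 0 →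
      ((primesEquiv (R := 𝓞 ℚ)).symm ⟨2, Nat.prime_two⟩).valuation ℚ W.j < 1 → (∀ d : ℤ, d = -1 ∨ d = 2 ∨ d = -2 → 2 ≤ (W.quadraticTwist (d : ℚ)).conductorExponent ((primesEquiv (R := ℤ)).symm ⟨2, Nat.prime_two⟩)) →
      (¬ (∀ z : ℂ, z ∈ periodLatticeGamma1 D.f ↔ ∃ w ∈ periodLattice D.f, z = 2 * w)))
    (h110 : ∀ (V : WeierstrassCurve ℚ) [V.IsElliptic] [V.IsGloballyMinimal] {N : ℕ} [NeZero N]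
      (D₁ : Gamma1ParametrizationData V N), D₁.IsOptimal → 2 ^ 4 ∣ N →
      (¬ ∃ (V' : WeierstrassCurve ℚ) (_ : V'.IsElliptic) (_ : V'.IsGloballyMinimal) (q m : ℤ),
        Odd q ∧ WeierstrassCurve.IsIsogenous V' V ∧ (q : ℝ) * V'.realPeriodRat = (m : ℝ) * V.realPeriodRat ∧
        IsSymbolClosureCurve V' D₁.f) →
      (∃ (W₀ : WeierstrassCurve ℚ) (_ : W₀.IsElliptic) (_ : W₀.IsGloballyMinimal) (D₀ : ModularParametrizationData W₀ N),
        IsIsogenous V W₀ ∧ (∀ z ∈ D₀.L.lattice, ∃ w ∈ periodLattice D₀.f, z = D₀.c * w) ∧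
        W₀.a₁ = 0 ∧ W₀.a₃ = 0 ∧ HasRationalTwoTorsion W₀ ∧
        ((primesEquiv (R := 𝓞 ℚ)).symm ⟨2, Nat.prime_two⟩).valuation ℚ W₀.j < 1 ∧ (∀ d : ℤ, d = -1 ∨ d = 2 ∨ d = -2 → 2 ≤ (W₀.quadraticTwist (d : ℚ)).conductorExponent ((primesEquiv (R := ℤ)).symm ⟨2, Nat.prime_two⟩))) →
      KatoFactTwoAt V D₁.f)
    :
    mazur_not_dvd_maninConstant_of_odd → abbesUllmo_not_dvd_maninConstant_of_not_dvd_level →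
      cesnavicius_not_two_dvd_maninConstant_of_two_dvd_level → exists_isNewformOf →
      ∀ (W : WeierstrassCurve ℚ) [W.IsElliptic] [W.IsGloballyMinimal] {N : ℕ} [NeZero N] (D : ModularParametrizationData W N),
        (∀ z ∈ D.L.lattice, ∃ w ∈ periodLattice D.f, z = D.c * w) → 2 ^ 4 ∣ N →
        ((primesEquiv (R := 𝓞 ℚ)).symm ⟨2, Nat.prime_two⟩).valuation ℚ W.j < 1 →
        (∀ d : ℤ, d = -1 ∨ d = 2 ∨ d = -2 → 2 ≤ (W.quadraticTwist (d : ℚ)).conductorExponent ((primesEquiv (R := ℤ)).symm ⟨2, Nat.prime_two⟩)) →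
        ¬ (2 : ℤ) ∣ D.maninConstant := by
  intro _hMz _hAU _hCs _hnf W _ _ N _ D hopt h16 hss hcore
  have h4 : 2 ^ 2 ∣ N := dvd_trans ⟨4, by norm_num⟩ h16
  exact not_two_dvd_maninConstant_of_levelKernelRows_core hF hex h4
    (fun V _ _ D' hopt' ha₁ ha₃ hssV hcV => h152 V D' hopt' h16 ha₁ ha₃ hssV hcV)
    (fun V _ _ D' hopt' ha₁ ha₃ hssV hcV => h152b V D' hopt' h16 ha₁ ha₃ hssV hcV)
    (fun V _ _ D₁ hD₁ hguard =>
      katoFactTwoAt_of_symbolClosure_of_periodRecut hK h4 V D₁ (fun hno => h110 V D₁ hD₁ h16 hno hguard)) W D hopt hss hcore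

/-- **THE ROUTE DECL `Theses.ManinLocalTwoThree.ManinOddAtFour` BY NAME by the KERNEL-ROW ROAD — SIX inputs**: F♯, hex, F-es-21♭K (statement-only) and
three laws read on the core at `16 ∣ N`: E-an-152, E-an-152b (an's `c`-free Shimura-kernel rows) and Kato–Néron integrality at the X₁-optimal curve of
reducible core classes off the period-dominated locus; through the core-preserving rotation and p2's `maninOddAtFour_of_core`.  The LEAD's FALLBACK to
skeleton v20 (whose reducible non-blind locus uses E-an-48/53 instead); not the line of record.  CONDITIONAL; C2, Manin's conjecture and BSD are NOT proved.
[cite: Kato2004Asterisque, Thm. 12.5 (1) (p. 221)] [cite: Stevens1989, §2 and Lemmas (5.2), (5.4)] [cite: LingOesterle1991, Thm. 6] -/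
theorem maninOddAtFour_of_katoFact_of_levelSixteenCoreKernelRows
    (hF : kato_neron_isIntegral_twistedSymbolSum_of_additive_two_real) (hex : exists_optimal_gamma1ParametrizationData)
    (hK : kato_isIntegral_twistedSymbolSum_two_symbolClosure)
    (h152 : ∀ (W : WeierstrassCurve ℚ) [W.IsElliptic] [W.IsGloballyMinimal] {N : ℕ} [NeZero N]
      (D : ModularParametrizationData W N),
      (∀ z ∈ D.L.lattice, ∃ w ∈ periodLattice D.f, z = D.c * w) → 2 ^ 4 ∣ N → W.a₁ = 0 → W.a₃ = 0 →
      ((primesEquiv (R := 𝓞 ℚ)).symm ⟨2, Nat.prime_two⟩).valuation ℚ W.j < 1 → (∀ d : ℤ, d = -1 ∨ d = 2 ∨ d = -2 → 2 ≤ (W.quadraticTwist (d : ℚ)).conductorExponent ((primesEquiv (R := ℤ)).symm ⟨2, Nat.prime_two⟩)) →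
      (periodLatticeGamma1 D.f ≠ periodLattice D.f →
        ∀ w ∈ periodLatticeGamma1 D.f, (∀ v ∈ periodLattice D.f, w ≠ 2 * v) →
          ∃ A₂ A₄ E : ℤ, (A₂ : ℚ) = W.a₂ ∧ (A₄ : ℚ) = W.a₄ ∧
            (E : ℚ) ^ 3 + W.a₂ * (E : ℚ) ^ 2 + W.a₄ * E + W.a₆ = 0 ∧
            D.L.weierstrassP ((D.c : ℂ) * w / 2) = (((E : ℚ) + W.a₂ / 3 : ℚ) : ℂ) ∧ KummerBlindAtTwo A₂ A₄ E))
    (h152b : ∀ (W : WeierstrassCurve ℚ) [W.IsElliptic] [W.IsGloballyMinimal] {N : ℕ} [NeZero N]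
      (D : ModularParametrizationData W N),
      (∀ z ∈ D.L.lattice, ∃ w ∈ periodLattice D.f, z = D.c * w) → 2 ^ 4 ∣ N → W.a₁ = 0 → W.a₃ = 0 →
      ((primesEquiv (R := 𝓞 ℚ)).symm ⟨2, Nat.prime_two⟩).valuation ℚ W.j < 1 → (∀ d : ℤ, d = -1 ∨ d = 2 ∨ d = -2 → 2 ≤ (W.quadraticTwist (d : ℚ)).conductorExponent ((primesEquiv (R := ℤ)).symm ⟨2, Nat.prime_two⟩)) →
      (¬ (∀ z : ℂ, z ∈ periodLatticeGamma1 D.f ↔ ∃ w ∈ periodLattice D.f, z = 2 * w)))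
    (h110 : ∀ (V : WeierstrassCurve ℚ) [V.IsElliptic] [V.IsGloballyMinimal] {N : ℕ} [NeZero N]
      (D₁ : Gamma1ParametrizationData V N), D₁.IsOptimal → 2 ^ 4 ∣ N →
      (¬ ∃ (V' : WeierstrassCurve ℚ) (_ : V'.IsElliptic) (_ : V'.IsGloballyMinimal) (q m : ℤ),
        Odd q ∧ WeierstrassCurve.IsIsogenous V' V ∧ (q : ℝ) * V'.realPeriodRat = (m : ℝ) * V.realPeriodRat ∧
        IsSymbolClosureCurve V' D₁.f) →
      (∃ (W₀ : WeierstrassCurve ℚ) (_ : W₀.IsElliptic) (_ : W₀.IsGloballyMinimal) (D₀ : ModularParametrizationData W₀ N),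
        IsIsogenous V W₀ ∧ (∀ z ∈ D₀.L.lattice, ∃ w ∈ periodLattice D₀.f, z = D₀.c * w) ∧
        W₀.a₁ = 0 ∧ W₀.a₃ = 0 ∧ HasRationalTwoTorsion W₀ ∧
        ((primesEquiv (R := 𝓞 ℚ)).symm ⟨2, Nat.prime_two⟩).valuation ℚ W₀.j < 1 ∧ (∀ d : ℤ, d = -1 ∨ d = 2 ∨ d = -2 → 2 ≤ (W₀.quadraticTwist (d : ℚ)).conductorExponent ((primesEquiv (R := ℤ)).symm ⟨2, Nat.prime_two⟩))) →
      KatoFactTwoAt V D₁.f)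
    : Summit.BirchSwinnertonDyer.BirchSwinnertonDyer.Theses.ManinLocalTwoThree.ManinOddAtFour :=
  maninOddAtFour_of_core
    (maninOddAtFourCore_of_maninOddAtSixteenCore
      (maninOddAtSixteenCore_of_katoFact_of_levelSixteenCoreKernelRows hF hex hK h152 h152b h110))

end Summit.BirchSwinnertonDyer.BirchSwinnertonDyer.Theorems.ManinLocalTwoThree

end
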